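import Literature.NumberTheory.Automorphic.Liu2021.NablaOfPieces
import Literature.NumberTheory.Automorphic.Liu2021.AlbaneseBaseChangeFact
import Literature.NumberTheory.Automorphic.Liu2021.AlbaneseBaseChange
import Literature.AlgebraicGeometry.Motives.Jacobian
import Literature.AlgebraicGeometry.Motives.AbelianVarietyProduct
import Literature.AlgebraicGeometry.Motives.AlbaneseByMaximality
import Literature.AlgebraicGeometry.HodgeTheory.SmoothProjectiveComponents
import HarnessLib

/-!
# Liu 2021 §2.1: the Albanese datum of a scheme split into geometrically irreducible pieces — EXISTENCE (`∇X' = ∐ Y_c × Y_c`,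
# `Alb_{X'} = ⨁ J_c`), PRODUCT decomposition for ANY datum, the Proposition over `ℂ`, and the DERIVATION of
# `albanese_baseChange_isLimit_fan_jacobian` from the comparison fact `albanese_baseChange`

Topic `Literature/NumberTheory/Automorphic/Liu2021` (sequel of `Liu2021/NablaOfPieces`, `…/AlbaneseBaseChangeFact`, `…/AlbaneseBaseChange`).
PROOF FILE: theorems only — no definition, no named fact, no global instance, sorry-free (D-0026 ±0).  [Liu2021] = Y. Liu, arXiv:2102.11518 = Camb. J. Math. 9 (2021); `l. NNNN` = lines of the author's TeX source as in
`Liu2021/AppendixC/Glue.lean` (structures `AppendixC.Nabla`, Def. 2.1 (1), and `AppendixC.Albanese`, Def. 2.3, l. 1190–1208).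

## What is proved

* `range_tensorHom_subset_range_of_diag`: for a geometrically irreducible piece `inj_c : Y_c ⟶ X'`, the image of `Y_c × Y_c` lies in
  EVERY open and closed subscheme of `X' × X'` through which the diagonal factors (minimality clause of Def. 2.1 (1)).
* **`Albanese.exists_of_isColimit`** / `Albanese.nonempty_of_isColimit`: over ANY field `L`, for a finite colimit cofan
  `inj_c : Y_c ⟶ X'` of geometrically irreducible `L`-schemes with Albanese data `𝒥 c : Motives.Jacobian (Y c)` (point-free form:
  difference map universal among morphisms trivial on the diagonal, Milne *Jacobian Varieties* Prop. 6.4 / Rem. 6.5), Liu's Albanese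
  datum of `X'` EXISTS — `∇X' :=` the open subscheme of `X' × X'` on the open and closed `⋃_c pr₁⁻¹(Y_c) ∩ pr₂⁻¹(Y_c)` (as a scheme
  the coproduct of the `Y_c × Y_c`, Mathlib `nonempty_isColimit_cofanMk_of`), `Alb_{X'} := ⨁_c J_c` (finite biproducts of abelian
  varieties as LOCAL instances from the tree's `AbelianVariety.prod` and `AbelianVariety.trivial`), `α := (diff_c ≫ ι_c)_c`,
  `desc f := ∑_c π_c ≫ (𝒥 c).desc (f|_{Y_c × Y_c})` — together with its biproduct projections as a limit fan.  This is the
  sentence of Liu's proof of the Proposition for a split scheme `X' = ⊔ᵢ Xᵢ` (l. 1194–1200: «the composite morphism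
  `∇_{k'}X' → Alb_{X'} ×_{k'} Alb_{X'} → Alb_{X'}` […] corepresents the functor `\underline{Alb}_{X'}`», `Alb_{X'} = ∏ᵢ Alb_{Xᵢ}`),
  with Serre's pointed Albanese replaced by Milne's point-free characterisation, so that no rational point is needed.
* **`Albanese.exists_isLimit_fan_of_isColimit`** (`…_of_isSmoothProjective`): for ANY Albanese datum `a` of such an `X'`, `a.Alb` is
  the product `∏_c J_c` (corepresenting objects are unique, `Albanese.nonempty_iso` of `Liu2021/NablaOfPieces`; transport).
* `Albanese.nonempty_complex`: Liu's Proposition (`Liu2021.exists_albanese`) HOLDS in the tree over `ℂ` for smooth projective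
  pure-dimensional `X` (`HodgeTheory.exists_components_isSmoothProjective_isColimit` + `Motives.nonempty_jacobian_of_isSmoothProjective_complex_of_dim`).
* **`albanese_baseChange_isLimit_fan_jacobian_of_albanese_baseChange`**: the composite named fact of `Liu2021/AlbaneseBaseChange`
  (the `hAlb` leaf of the COR-CM `hComp` closer, cells pub-hodgecm / pub-hodgecm2) FOLLOWS from the one-sentence COMPARISON fact
  `Liu2021.albanese_baseChange` (`Liu2021/AlbaneseBaseChangeFact`): construct a datum of `X ⊗_{k,σ} L ≅ ∐_c Y_c` from the pieces,
  compare by the fact, decompose, transport.  A consumer holding `h′ : albanese_baseChange` instantiates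
  `hA := albanese_baseChange_isLimit_fan_jacobian_of_albanese_baseChange h′`; no landed file is edited.

Mathlib/tree API used: `nonempty_isColimit_cofanMk_of`, `IsOpenImmersion.lift`, `IsClosedImmersion.of_isPreimmersion`, `Scheme.Pullback.range_map`,
`MorphismProperty.pullbackMap`, `biproduct.*`, `hasTerminal_of_unique`, `HasFiniteBiproducts.of_hasFiniteProducts`, `Grp.uniqueHomToTrivial`,
`Fan.IsLimit.mk`, `Fan.ext`, `IsLimit.ofIsoLimit`; tree `Morphisms/ClopenPieceOfCoproduct`, `Motives/Jacobian`, `AbelianVariety.prod/trivial`.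

## References

* [Liu2021] Y. Liu, arXiv:2102.11518 = Camb. J. Math. 9 (2021): §2.1 Def. 2.1 (1) (l. 1171–1174), Proposition (l. 1190–1192) with
  proof (l. 1194–1200), Def. 2.3 (l. 1202–1208), Lemma 2.2 (1) (l. 1211–1213, proof l. 1220–1228); §4.2 l. 2060–2066.
* [Milne1986JacobianVarieties] J. S. Milne, *Jacobian Varieties* (1986), §6 Prop. 6.4, Rem. 6.5.  [MumfordAV1970] D. Mumford,
  *Abelian Varieties* (1970), §19.  [Serre1958MorphismesUniversels] J.-P. Serre, Sém. Chevalley 4 (1958/59), exp. 10 (Liu's [Ser59]).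
-/

noncomputable section

open CategoryTheory CategoryTheory.Limits AlgebraicGeometry MonoidalCategory CartesianMonoidalCategory
open Literature.AlgebraicGeometry.Motives
open scoped MonObj

universe u

namespace Literature.NumberTheory.Automorphic.Liu2021.AppendixC

section Construction

universe v

variable {L : Type u} [Field L]
variable {X' : SchemeOver L} {κ : Type v} [Small.{u} κ] {Y : κ → SchemeOver L} {inj : ∀ c, Y c ⟶ X'}

/-- The image of `f × g : X × Y → X'' × Y''` (fibre products over `Spec L`) is `pr₁⁻¹(f(X)) ∩ pr₂⁻¹(g(Y))` — Mathlib
`Scheme.Pullback.range_map` in the cartesian monoidal `Over (Spec L)`. [folklore] -/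
private theorem range_tensorHom_left' {X Y X'' Y'' : SchemeOver L} (f : X ⟶ X'') (g : Y ⟶ Y'') :
    Set.range (f ⊗ₘ g).left = (fst X'' Y'').left ⁻¹' Set.range f.left ∩
      (snd X'' Y'').left ⁻¹' Set.range g.left := by
  rw [Over.tensorHom_left]
  exact Scheme.Pullback.range_map _ _ _ _ _ _ _ _ _

omit [Small.{u} κ] in
/-- **The self-product of a geometrically irreducible piece lies in every open and closed subscheme of `X' × X'` through
which the diagonal factors** (the image of the irreducible `Y_c ×_L Y_c` is preconnected and meets the open and closed image
of `j` on the diagonal; Mathlib `IsPreconnected.subset_isClopen`).  This is the MINIMALITY clause of Def. 2.1 (1) («the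
smallest open and closed subscheme of `X × X` containing the diagonal») for the candidate `⋃_c Y_c × Y_c`.  Ours. [cite: Liu2021, §2.1 Def. 2.1 (1) (l. 1171–1174)] -/
theorem range_tensorHom_subset_range_of_diag {W : SchemeOver L} (j : W ⟶ X' ⊗ X') [IsOpenImmersion j.left]
    [IsClosedImmersion j.left] {δ : X' ⟶ W} (hδ : δ ≫ j = lift (𝟙 X') (𝟙 X')) (c : κ)
    [GeometricallyIrreducible (Y c).hom] :
    Set.range (inj c ⊗ₘ inj c).left ⊆ Set.range j.left := by
  haveI : IrreducibleSpace (Y c).left :=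
    GeometricallyIrreducible.irreducibleSpace_of_subsingleton (Y c).hom
  haveI : IrreducibleSpace ↥(Y c ⊗ Y c).left := by
    change IrreducibleSpace ↥(pullback (Y c).hom (Y c).hom)
    infer_instance
  have hpre : _root_.IsPreconnected (Set.range ⇑(inj c ⊗ₘ inj c).left) :=
    isPreconnected_range (inj c ⊗ₘ inj c).left.continuous
  have hT : IsClopen (Set.range ⇑j.left) :=
    ⟨j.left.isClosedEmbedding.isClosed_range, IsOpenImmersion.isOpen_range j.left⟩
  obtain ⟨y⟩ := (inferInstance : Nonempty (Y c).left)
  refine hpre.subset_isClopen hT ⟨(lift (inj c) (inj c)).left y, ?_, ?_⟩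
  · refine ⟨(lift (𝟙 (Y c)) (𝟙 (Y c))).left y, ?_⟩
    rw [← Scheme.Hom.comp_apply, ← Over.comp_left, lift_map]
    simp
  · refine ⟨δ.left ((inj c).left y), ?_⟩
    rw [← Scheme.Hom.comp_apply, ← Scheme.Hom.comp_apply, ← Over.comp_left, ← Over.comp_left,
      hδ, comp_lift, Category.comp_id]

omit [Small.{u} κ] in
/-- Precomposition distributes over a finite pointwise product of morphisms into a group scheme. [folklore] -/
private theorem comp_finsetProd' {X Z : SchemeOver L} {B : AbelianVariety L} (f : X ⟶ Z) (s : Finset κ)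
    (g : κ → (Z ⟶ B.X)) : f ≫ ∏ c ∈ s, g c = ∏ c ∈ s, f ≫ g c := by
  classical
  induction s using Finset.induction_on with
  | empty => rw [Finset.prod_empty, Finset.prod_empty, MonObj.comp_one]
  | insert c s hc ih => rw [Finset.prod_insert hc, Finset.prod_insert hc, MonObj.comp_mul, ih]

omit [Small.{u} κ] in
/-- The underlying morphism of a finite sum of homomorphisms of abelian varieties is the pointwise product of the
underlying morphisms (Mumford §19). [folklore] -/
private theorem hom_hom_hom_sum' {A B : AbelianVariety L} (s : Finset κ) (f : κ → (A ⟶ B)) :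
    (∑ c ∈ s, f c).hom.hom.hom = ∏ c ∈ s, (f c).hom.hom.hom := by
  classical
  induction s using Finset.induction_on with
  | empty => rfl
  | insert c s hc ih => rw [Finset.sum_insert hc, Finset.prod_insert hc, ← ih]; rfl

/-- **[Liu2021, §2.1, proof of the Proposition] The Albanese datum of a scheme split into geometrically irreducible pieces
carrying Albanese data EXISTS, and its Albanese variety is the PRODUCT of those of the pieces (construction).**  For ANY field
`L`, a finite colimit cofan `inj_c : Y_c ⟶ X'` (`X' ≅ ∐_c Y_c`) of geometrically irreducible `L`-schemes and Albanese data
`𝒥 c : Motives.Jacobian (Y c)` (Milne Prop. 6.4 / Remark 6.5), there is `a : Albanese X'` (Def. 2.3) with projections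
`π_c : a.Alb ⟶ (𝒥 c).J` forming a limit fan.  CONSTRUCTION (module docstring): `∇X' := ∐_c Y_c × Y_c ↪ X' × X'` (open and
closed, contains the diagonal, MINIMAL by `range_tensorHom_subset_range_of_diag`), `Alb_{X'} := ⨁_c J_c`, `α := (diff_c ≫ ι_c)_c`,
`desc f := ∑_c π_c ≫ (𝒥 c).desc (f|_{Y_c × Y_c})`; `fac`/`uniq` from those of the `𝒥 c`, the coproduct `∇X' = ∐ Y_c × Y_c` and the
biproduct calculus.  Liu, l. 1194–1200, for the split scheme `X' = ⊔ᵢ Xᵢ`: «the composite morphism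
`∇_{k'}X' → Alb_{X'} ×_{k'} Alb_{X'} → Alb_{X'}` […] corepresents the functor `\underline{Alb}_{X'}`» with `Alb_{X'} = ∏ᵢ Alb_{Xᵢ}`
— here with Milne's point-free Albanese data of the pieces, so that no rational point and no hypothesis on `L` is needed.  Ours.
[cite: Liu2021, §2.1 Def. 2.1 (1) (l. 1171–1174), Proposition (l. 1190–1192) with proof (l. 1194–1200), Def. 2.3 (l. 1202–1208)]
[cite: Milne1986JacobianVarieties, §6 Prop. 6.4, Remark 6.5] [cite: MumfordAV1970, §19 (p. 174)] -/
theorem Albanese.exists_of_isColimit [Fintype κ] (hcol : IsColimit (Cofan.mk X' inj))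
    (𝒥 : ∀ c, Jacobian (Y c)) (hirr : ∀ c, GeometricallyIrreducible (Y c).hom) :
    ∃ (a : Albanese X') (π : ∀ c, a.Alb ⟶ (𝒥 c).J), Nonempty (IsLimit (Fan.mk a.Alb π)) := by
  classical
  haveI := hirr
  haveI := fun c => isOpenImmersion_left_of_isColimit hcol c
  -- finite biproducts of abelian varieties (Mumford §19), as LOCAL instances
  haveI : HasTerminal (AbelianVariety L) :=
    haveI : ∀ B : AbelianVariety L, Unique (B ⟶ AbelianVariety.trivial L) := fun B =>
      haveI : Unique (B.toGrp ⟶ (AbelianVariety.trivial L).toGrp) := Grp.uniqueHomToTrivial B.toGrp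
      InducedCategory.homEquiv.unique
    hasTerminal_of_unique (AbelianVariety.trivial L)
  haveI : HasFiniteProducts (AbelianVariety L) := hasFiniteProducts_of_has_binary_and_terminal
  haveI : HasFiniteBiproducts (AbelianVariety L) := HasFiniteBiproducts.of_hasFiniteProducts
  -- §1 the carrier `∇X'` : the open subscheme of `X' × X'` on `U = ⋃_c pr₁⁻¹ Y_c ∩ pr₂⁻¹ Y_c`
  set R : κ → Set X'.left := fun c => Set.range (inj c).left with hR
  set U : Set ↥(X' ⊗ X').left :=
    ⋃ c, ⇑(fst X' X').left ⁻¹' R c ∩ ⇑(snd X' X').left ⁻¹' R c with hU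
  have hRc : ∀ c, IsClopen (R c) := fun c => isClopen_range_left_of_isColimit hcol c
  have hUo : IsOpen U := isOpen_iUnion fun c =>
    ((hRc c).2.preimage (fst X' X').left.continuous).inter
      ((hRc c).2.preimage (snd X' X').left.continuous)
  have hUc : IsClosed U := isClosed_iUnion_of_finite fun c =>
    ((hRc c).1.preimage (fst X' X').left.continuous).inter
      ((hRc c).1.preimage (snd X' X').left.continuous)
  have hUc' : ∀ c, Set.range ⇑(inj c ⊗ₘ inj c).left = ⇑(fst X' X').left ⁻¹' R c ∩ ⇑(snd X' X').left ⁻¹' R c :=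
    fun c => range_tensorHom_left' _ _
  obtain ⟨Uo, hUo_range⟩ : ∃ Uo : (X' ⊗ X').left.Opens, Set.range ⇑Uo.ι = U :=
    ⟨⟨U, hUo⟩, Scheme.Opens.range_ι _⟩
  let NN : SchemeOver L := Over.mk (Uo.ι ≫ (X' ⊗ X').hom)
  let incl : NN ⟶ X' ⊗ X' := Over.homMk Uo.ι rfl
  have hjo : IsOpenImmersion Uo.ι := inferInstance
  have hjc : IsClosedImmersion Uo.ι :=
    IsClosedImmersion.of_isPreimmersion Uo.ι (by rw [hUo_range]; exact hUc)
  -- the diagonal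
  have hdiag : Set.range ⇑(lift (𝟙 X') (𝟙 X')).left ⊆ Set.range ⇑Uo.ι := by
    rw [hUo_range]
    rintro _ ⟨x, rfl⟩
    obtain ⟨c, y, hy⟩ := exists_eq_left_of_isColimit hcol x
    refine Set.mem_iUnion.mpr ⟨c, ?_, ?_⟩
    · show (fst X' X').left ((lift (𝟙 X') (𝟙 X')).left x) ∈ R c
      rw [← Scheme.Hom.comp_apply, ← Over.comp_left, lift_fst]
      exact ⟨y, hy⟩
    · show (snd X' X').left ((lift (𝟙 X') (𝟙 X')).left x) ∈ R c
      rw [← Scheme.Hom.comp_apply, ← Over.comp_left, lift_snd]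
      exact ⟨y, hy⟩
  let d₀ := IsOpenImmersion.lift Uo.ι (lift (𝟙 X') (𝟙 X')).left hdiag
  have hd₀ : d₀ ≫ Uo.ι = (lift (𝟙 X') (𝟙 X')).left := IsOpenImmersion.lift_fac _ _ _
  let diag : X' ⟶ NN := Over.homMk d₀ (by
    change d₀ ≫ Uo.ι ≫ (X' ⊗ X').hom = X'.hom
    rw [← Category.assoc, hd₀]
    exact Over.w (lift (𝟙 X') (𝟙 X')))
  have hdiag_incl : diag ≫ incl = lift (𝟙 X') (𝟙 X') := Over.OverMorphism.ext hd₀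
  -- the pieces `Y_c × Y_c ⟶ ∇X'`
  have hsub : ∀ c, Set.range ⇑(inj c ⊗ₘ inj c).left ⊆ Set.range ⇑Uo.ι := fun c => by
    rw [hUo_range, hUc']
    exact Set.subset_iUnion (fun c => ⇑(fst X' X').left ⁻¹' R c ∩ ⇑(snd X' X').left ⁻¹' R c) c
  let l₀ := fun c => IsOpenImmersion.lift Uo.ι (inj c ⊗ₘ inj c).left (hsub c)
  have hl₀ : ∀ c, l₀ c ≫ Uo.ι = (inj c ⊗ₘ inj c).left := fun c => IsOpenImmersion.lift_fac _ _ _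
  let l : ∀ c, Y c ⊗ Y c ⟶ NN := fun c => Over.homMk (l₀ c) (by
    change l₀ c ≫ Uo.ι ≫ (X' ⊗ X').hom = (Y c ⊗ Y c).hom
    rw [← Category.assoc, hl₀]
    exact Over.w _)
  have hl : ∀ c, l c ≫ incl = inj c ⊗ₘ inj c := fun c => Over.OverMorphism.ext (hl₀ c)
  have hlo : ∀ c, IsOpenImmersion (l c).left := fun c => by
    have h1 : IsOpenImmersion ((l c).left ≫ Uo.ι) := by
      change IsOpenImmersion (l₀ c ≫ Uo.ι)
      rw [hl₀, Over.tensorHom_left]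
      exact MorphismProperty.pullbackMap (P := @IsOpenImmersion)
        (isOpenImmersion_left_of_isColimit hcol c) (isOpenImmersion_left_of_isColimit hcol c)
        (Over.w (inj c)).symm (Over.w (inj c)).symm
    exact @IsOpenImmersion.of_comp _ _ _ (l c).left Uo.ι hjo h1
  -- `∇X'` is the coproduct of the pieces (as schemes)
  have hm : Mono incl.left := (inferInstance : Mono Uo.ι)
  have hmono : Mono incl := @Over.mono_of_mono_left _ _ _ _ _ incl hm
  have hkey : ∀ c, lift (𝟙 (Y c)) (𝟙 (Y c)) ≫ l c = inj c ≫ diag := fun c => by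
    rw [← cancel_mono incl, Category.assoc, hl, Category.assoc, hdiag_incl]
    simp only [lift_map, comp_lift, Category.id_comp, Category.comp_id]
  have hcov : ∀ n : NN.left, ∃ (c : κ) (z : (Y c ⊗ Y c).left), (l c).left z = n := by
    intro n
    have hn : Uo.ι n ∈ U := by rw [← hUo_range]; exact ⟨n, rfl⟩
    obtain ⟨c, hc⟩ := Set.mem_iUnion.mp hn
    rw [← hUc'] at hc
    obtain ⟨z, hz⟩ := hc
    refine ⟨c, z, Uo.ι.isOpenEmbedding.injective ?_⟩
    rw [← hz, ← hl₀ c]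
    exact (Scheme.Hom.comp_apply _ _ _).symm
  have hcovU : ⨆ c, ((l c).left).opensRange = ⊤ := by
    refine top_unique fun n _ => ?_
    obtain ⟨c, z, hz⟩ := hcov n
    exact TopologicalSpace.Opens.mem_iSup.mpr ⟨c, ⟨z, hz⟩⟩
  have hdisjU : Pairwise (Function.onFun Disjoint fun c => ((l c).left).opensRange) := by
    intro c d hcd
    refine disjoint_iff_inf_le.mpr fun n ⟨⟨a, ha⟩, ⟨b, hb⟩⟩ => ?_
    have ha' : Uo.ι n ∈ Set.range ⇑(inj c ⊗ₘ inj c).left := ⟨a, by rw [← ha, ← hl₀ c, Scheme.Hom.comp_apply]; rfl⟩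
    have hb' : Uo.ι n ∈ Set.range ⇑(inj d ⊗ₘ inj d).left := ⟨b, by rw [← hb, ← hl₀ d, Scheme.Hom.comp_apply]; rfl⟩
    rw [hUc'] at ha' hb'
    exact Set.disjoint_left.mp (disjoint_range_left_of_isColimit hcol hcd) ha'.1 hb'.1
  haveI := hlo
  obtain ⟨hNcol⟩ := nonempty_isColimit_cofanMk_of (fun c => (l c).left) hcovU hdisjU
  -- §2 the abelian variety and `α`
  let A : AbelianVariety L := ⨁ fun c => (𝒥 c).J
  let αc : ∀ c, Y c ⊗ Y c ⟶ A.X := fun c => (𝒥 c).diff ≫ (biproduct.ι (fun c => (𝒥 c).J) c).hom.hom.hom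
  let α₀ : NN.left ⟶ A.X.left := Cofan.IsColimit.desc hNcol fun c => (αc c).left
  have hα₀ : ∀ c, (l c).left ≫ α₀ = (αc c).left := fun c => Cofan.IsColimit.fac hNcol _ c
  let α : NN ⟶ A.X := Over.homMk α₀ (by
    refine Cofan.IsColimit.hom_ext hNcol _ _ fun c => ?_
    change (l c).left ≫ α₀ ≫ A.X.hom = (l c).left ≫ NN.hom
    rw [← Category.assoc, hα₀, Over.w, Over.w])
  have hα : ∀ c, l c ≫ α = αc c := fun c => Over.OverMorphism.ext (hα₀ c)
  -- §3 the carrier structure `∇X'`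
  let N : Nabla X' :=
    { N := NN, incl := incl, isOpenImmersion_incl := hjo, isClosedImmersion_incl := hjc, diag := diag
      diag_incl := hdiag_incl
      minimal := fun W j hWo hWc hδ => by
        obtain ⟨δ, hδ⟩ := hδ
        haveI := hWo
        haveI := hWc
        have hsubW : Set.range ⇑Uo.ι ⊆ Set.range ⇑j.left := by
          rw [hUo_range]
          intro z hz
          obtain ⟨c, hc⟩ := Set.mem_iUnion.mp hz
          rw [← hUc'] at hc
          exact range_tensorHom_subset_range_of_diag j hδ c hc
        let f₀ := IsOpenImmersion.lift j.left Uo.ι hsubW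
        have hf₀ : f₀ ≫ j.left = Uo.ι := IsOpenImmersion.lift_fac _ _ _
        have hw : f₀ ≫ W.hom = Uo.ι ≫ (X' ⊗ X').hom := by rw [← Over.w j, ← Category.assoc, hf₀]
        exact ⟨Over.homMk f₀ hw, Over.OverMorphism.ext hf₀⟩ }
  -- §4 the universal property
  have hdiagα : diag ≫ α = 1 := by
    refine Cofan.IsColimit.hom_ext hcol _ _ fun c => ?_
    change inj c ≫ diag ≫ α = inj c ≫ 1
    rw [← Category.assoc, ← hkey, Category.assoc, hα, MonObj.comp_one]
    change lift (𝟙 (Y c)) (𝟙 (Y c)) ≫ (𝒥 c).diff ≫ _ = 1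
    rw [← Category.assoc, (𝒥 c).diag_diff, MonObj.one_comp]
  have hlf : ∀ {B : AbelianVariety L} (f : NN ⟶ B.X), diag ≫ f = 1 →
      ∀ c, lift (𝟙 (Y c)) (𝟙 (Y c)) ≫ l c ≫ f = 1 := by
    intro B f hf c
    rw [← Category.assoc, hkey, Category.assoc, hf, MonObj.comp_one]
  let descF : ∀ {B : AbelianVariety L} (f : NN ⟶ B.X), diag ≫ f = 1 → (A ⟶ B) := fun {B} f hf =>
    ∑ c, biproduct.π (fun c => (𝒥 c).J) c ≫ (𝒥 c).desc (l c ≫ f) (hlf f hf c)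
  have hιdesc : ∀ {B : AbelianVariety L} (f : NN ⟶ B.X) (hf : diag ≫ f = 1) (c : κ),
      biproduct.ι (fun c => (𝒥 c).J) c ≫ descF f hf = (𝒥 c).desc (l c ≫ f) (hlf f hf c) := by
    intro B f hf c
    simp only [descF, Preadditive.comp_sum]
    rw [Finset.sum_eq_single c]
    · rw [biproduct.ι_π_self_assoc]
    · intro d _ hdc
      rw [biproduct.ι_π_ne_assoc _ (Ne.symm hdc), zero_comp]
    · intro hc
      exact absurd (Finset.mem_univ c) hc
  have hfac : ∀ {B : AbelianVariety L} (f : NN ⟶ B.X) (hf : diag ≫ f = 1),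
      α ≫ (descF f hf).hom.hom.hom = f := by
    intro B f hf
    apply Over.OverMorphism.ext
    refine Cofan.IsColimit.hom_ext hNcol _ _ fun c => ?_
    change (l c).left ≫ (α ≫ (descF f hf).hom.hom.hom).left = (l c).left ≫ f.left
    rw [← Over.comp_left, ← Over.comp_left]
    congr 1
    rw [← Category.assoc, hα]
    change (𝒥 c).diff ≫ (biproduct.ι (fun c => (𝒥 c).J) c ≫ descF f hf).hom.hom.hom = l c ≫ f
    rw [hιdesc f hf c, (𝒥 c).fac]
  have huniq : ∀ {B : AbelianVariety L} (f : NN ⟶ B.X) (hf : diag ≫ f = 1) (ψ : A ⟶ B),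
      α ≫ ψ.hom.hom.hom = f → ψ = descF f hf := by
    intro B f hf ψ hψ
    refine biproduct.hom_ext' _ _ fun c => ?_
    rw [hιdesc f hf c]
    refine (𝒥 c).uniq _ _ _ ?_
    change ((𝒥 c).diff ≫ (biproduct.ι (fun c => (𝒥 c).J) c).hom.hom.hom) ≫ ψ.hom.hom.hom = l c ≫ f
    rw [← hψ, ← Category.assoc, hα]
  -- §5 the biproduct is a product
  have hlim : IsLimit (Fan.mk A fun c => biproduct.π (fun c => (𝒥 c).J) c) :=
    Fan.IsLimit.mk _ (fun t => biproduct.lift fun c => t.proj c)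
      (fun t c => biproduct.lift_π _ _)
      (fun t m hm => biproduct.hom_ext _ _ fun c => by rw [biproduct.lift_π]; exact hm c)
  exact ⟨{ nabla := N, Alb := A, α := α, diag_α := hdiagα, desc := descF, fac := hfac, uniq := huniq },
    fun c => biproduct.π (fun c => (𝒥 c).J) c, ⟨hlim⟩⟩

/-- **Liu's Proposition for a split scheme**: under the hypotheses of `Albanese.exists_of_isColimit` (any field `L`, finite
colimit cofan of geometrically irreducible pieces with Albanese data `𝒥 c`), `X'` HAS an Albanese datum in the sense of
Def. 2.3.  Ours (construction). [cite: Liu2021, §2.1 Proposition (l. 1190–1192) with proof (l. 1194–1200)] -/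
theorem Albanese.nonempty_of_isColimit [Fintype κ] (hcol : IsColimit (Cofan.mk X' inj))
    (𝒥 : ∀ c, Jacobian (Y c)) (hirr : ∀ c, GeometricallyIrreducible (Y c).hom) :
    Nonempty (Albanese X') := by
  obtain ⟨a, -, -⟩ := Albanese.exists_of_isColimit hcol 𝒥 hirr
  exact ⟨a⟩

/-- **[Liu2021, §2.1] The Albanese variety of a scheme split into geometrically irreducible pieces is the product of the
Albanese varieties of the pieces — for ANY Albanese datum.**  For ANY field `L`, any `a : AppendixC.Albanese X'` (Def. 2.3), a
finite colimit cofan `inj_c : Y_c ⟶ X'` of geometrically irreducible `L`-schemes and `𝒥 c : Jacobian (Y c)`, there are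
homomorphisms `π_c : Alb_{X'} → J_c` making `a.Alb` the PRODUCT `∏_c J_c` in `AbelianVariety L` (a limit fan): the constructed
datum `a₀` of `Albanese.exists_of_isColimit` has this property, and a corepresenting object is unique up to isomorphism
(`Albanese.nonempty_iso`, `Liu2021/NablaOfPieces`; «the abelian variety that corepresents the functor», l. 1203), so the limit
fan transports along `a.Alb ≅ a₀.Alb`. [cite: Liu2021, §2.1 Proposition (l. 1190–1192) and its proof (l. 1194–1200), Def. 2.3 (l. 1202–1208)]
[cite: Milne1986JacobianVarieties, §6 Prop. 6.4, Remark 6.5] -/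
theorem Albanese.exists_isLimit_fan_of_isColimit [Fintype κ] (a : Albanese X')
    (hcol : IsColimit (Cofan.mk X' inj)) (𝒥 : ∀ c, Jacobian (Y c))
    (hirr : ∀ c, GeometricallyIrreducible (Y c).hom) :
    ∃ π : ∀ c, a.Alb ⟶ (𝒥 c).J, Nonempty (IsLimit (Fan.mk a.Alb π)) := by
  obtain ⟨a₀, π₀, ⟨h₀⟩⟩ := Albanese.exists_of_isColimit hcol 𝒥 hirr
  obtain ⟨e⟩ := Albanese.nonempty_iso a a₀
  exact ⟨fun c => e.hom ≫ π₀ c,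
    ⟨IsLimit.ofIsoLimit h₀ (Fan.ext e.symm fun c => (e.inv_hom_id_assoc (π₀ c)).symm)⟩⟩

/-- **The same for smooth projective geometrically irreducible pieces** (the tree's `IsSmoothProjective n`, which carries
`GeometricallyIrreducible`): for ANY Albanese datum `a` of `X' ≅ ∐_c Y_c` and Albanese data `𝒥 c : Jacobian (Y c)` of the
pieces, `a.Alb` is the product `∏_c (𝒥 c).J` — the shape consumed by `Liu2021/AlbaneseBaseChange.lean` (binder `hAlb` of the
COR-CM `hComp` closer). [cite: Liu2021, §2.1 Proposition (l. 1190–1192) and its proof (l. 1194–1200)] -/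
theorem Albanese.exists_isLimit_fan_of_isSmoothProjective [Fintype κ] (a : Albanese X')
    (hcol : IsColimit (Cofan.mk X' inj)) (𝒥 : ∀ c, Jacobian (Y c)) {n : ℕ}
    (hY : ∀ c, IsSmoothProjective n (Y c)) :
    ∃ π : ∀ c, a.Alb ⟶ (𝒥 c).J, Nonempty (IsLimit (Fan.mk a.Alb π)) :=
  a.exists_isLimit_fan_of_isColimit hcol 𝒥 fun c => (hY c).geometricallyIrreducible

end Construction

/-! ## Liu's Proposition over `ℂ` for smooth projective schemes: a theorem of the tree -/

/-- **[Liu2021, §2.1, Proposition] holds in the tree over `k = ℂ` for smooth projective pure-dimensional schemes.**  A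
smooth projective complex scheme `X` of pure dimension `d` (not assumed connected) carries an Albanese datum in the sense of
Def. 2.3 — `Nonempty (AppendixC.Albanese X)`, i.e. the named fact `Liu2021.exists_albanese` (`Liu2021/AlbaneseBaseChange`)
at `k = ℂ` with «proper» strengthened to «projective»: `X` is the coproduct of its finitely many smooth projective
geometrically irreducible components (tree `HodgeTheory.exists_components_isSmoothProjective_isColimit`), each carries an
Albanese datum in Milne's point-free form (tree `Motives.nonempty_jacobian_of_isSmoothProjective_complex_of_dim`, Serre's
universal-morphism criterion), and `AppendixC.Albanese.nonempty_of_isColimit` (`Liu2021/AlbaneseOfPieces`) assembles them.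
This is the case of Liu's compactified Shimura varieties after base change to `ℂ` (§4.2, l. 2060–2066: «smooth projective
schemes […] of dimension `n − 1`»).  Ours. [cite: Liu2021, §2.1 Proposition (l. 1190–1192) with proof (l. 1194–1200)] -/
theorem Albanese.nonempty_complex {d : ℕ} (X : SchemeOver ℂ) [SmoothOfRelativeDimension d X.hom]
    (hX : IsProjectiveOver X) : Nonempty (Albanese X) := by
  obtain ⟨C, _, E, e, hE, -, -, -, ⟨hcol⟩⟩ :=
    Literature.AlgebraicGeometry.HodgeTheory.exists_components_isSmoothProjective_isColimit (X := X) (d := d) hX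
  haveI := Fintype.ofFinite C
  exact Albanese.nonempty_of_isColimit hcol
    (fun c => (nonempty_jacobian_of_isSmoothProjective_complex_of_dim (E c) (hE c)).some)
    fun c => (hE c).geometricallyIrreducible

end Literature.NumberTheory.Automorphic.Liu2021.AppendixC

/-! ## The composite fact of `Liu2021/AlbaneseBaseChange` derived from `albanese_baseChange` -/

namespace Literature.NumberTheory.Automorphic.Liu2021

/-- **`albanese_baseChange ⟹ albanese_baseChange_isLimit_fan_jacobian`.**  The composite cited fact of
`Liu2021/AlbaneseBaseChange.lean` — for `σ : k →+* L` (`k` of characteristic zero, `L` algebraically closed), a proper smooth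
`X/k` with a Liu Albanese datum `a`, and any finite coproduct decomposition `X ⊗_{k,σ} L ≅ ∐_c Y_c` into smooth projective
geometrically irreducible `L`-schemes with Albanese data `𝒥 c : Jacobian (Y c)`, the base change `Alb_X ⊗_{k,σ} L` is the
product `∏_c (𝒥 c).J` — FOLLOWS from the one-sentence COMPARISON fact `albanese_baseChange` (`a'.Alb ≅ Alb_X ⊗_{k,σ} L` for
any Albanese data `a` of `X` and `a'` of `X ⊗_{k,σ} L`) and the tree's theorems `AppendixC.Albanese.nonempty_of_isColimit`
(an Albanese datum `a'` of `X ⊗_{k,σ} L ≅ ∐_c Y_c` EXISTS, built from the `𝒥 c`; file `Liu2021/AlbaneseOfPieces`) and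
`AppendixC.Albanese.exists_isLimit_fan_of_isSmoothProjective` (`a'.Alb` is `∏_c J_c`), the limit fan being transported along
the isomorphism (`Fan.ext`, `IsLimit.ofIsoLimit`).  Hence clauses (i) and (iii) of that fact's SOURCE MAP, and the existence of
the datum over `L`, are theorems, and its cited content is exactly `albanese_baseChange` = (a)+(ii).  Ours. [cite: Liu2021, §2.1 Proposition (l. 1190–1192) with proof (l. 1194–1200) and Lemma 2.2 (1) (proof, l. 1220–1228)] -/
theorem albanese_baseChange_isLimit_fan_jacobian_of_albanese_baseChange (h : albanese_baseChange) :
    albanese_baseChange_isLimit_fan_jacobian := by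
  intro k L _ _ _ _ σ X hXp hXs a n κ _ Y inj 𝒥 hY hcol
  obtain ⟨a'⟩ := AppendixC.Albanese.nonempty_of_isColimit hcol.some 𝒥 fun c => (hY c).geometricallyIrreducible
  obtain ⟨e⟩ := h k L σ X hXp hXs a a'
  obtain ⟨π, ⟨hπ⟩⟩ := a'.exists_isLimit_fan_of_isSmoothProjective hcol.some 𝒥 hY
  exact ⟨fun c => e.inv ≫ π c, ⟨IsLimit.ofIsoLimit hπ (Fan.ext e fun c => (e.hom_inv_id_assoc (π c)).symm)⟩⟩

end Literature.NumberTheory.Automorphic.Liu2021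

end
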